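import Summits.CriticalPhenomena.PercolationContinuityZ3.Theorems.Transplant.SqShadowSide
import Summits.CriticalPhenomena.PercolationContinuityZ3.Theorems.Transplant.HexShadowSideSqrt
import HarnessLib

/-!
# SQUARE SHADOWS VII — the two inputs of DST's Lemma 4 in square geometry: the local bound `P[E_m(x, x)] ≤ c < 1` (closed neighbourhoods of a column,
# uniformly in the scale and the position by the lifted translations) and `P[E_m(0, m)] → 1` (the square-root trick over the EIGHT half-sides of the square:
# four quarter turns, one flip)

builds on p205010 (kernel theorem, internal audit signed; external expert review pending) — NOT used in this file.
Lane `prim-bschramm`, seat `prim-bschramm-p2` (gen 42; class C1b; memo `HOME/bschramm/P2-LATTICES.md` §148); helper file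
(`--supports stmt-CriticalPhenomena-4575 --as helper`).  Hexagonal twin «HexShadowSideSqrt», whose shadow-free §1–§2 (`sqrt_trick_two_graph`, `sqrt_trick_equiprobable`,
`edgesClosed`, `real_edgesClosed_pos`, `preimage_relabel_edgesClosed`) are reused by name; slab original `Literature/…/SlabCriticality` §"Lemma4Tools".
* §1 closed neighbourhoods over squares: transport along the lifted translations (`real_edgesClosed_shift`); the UNIFORM constant
  `closedConst Ψ p = P_p[all edges over sqBall c (2·period) closed]` bounds `P_p[all edges over sqBall q 1 closed]` from below for EVERY `q ∈ ℤ²` (reduce `q − c` modulo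
  `period` and translate: `exists_sqBall_one_subset`, `closedConst_le`);
* §2 the local bound: an open path from `\overline{X}` to the column over a point `q ∉ X` uses an open edge over `sqBall q 1` (each shadow coordinate moves by at most
  one along an edge), whence `P[X ⟷^B {q}] ≤ 1 − closedConst` and **`real_sideEvent_point_le`**: `P[E_m(x, x)] ≤ 1 − closedConst` (`u < m`);
* §3 **`tendsto_real_sideEvent_upper`**: `P[sqBall c v_m ⟷^{sqBall c m} sqRing c m] → 1 ⇒ P[E_m(0, m)] → 1`, with `P[E_m(−m,m)] ≥ 1 − (1 − P[· ⟷ sqRing])^{1/4}`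
  (four turned sides) and then the flip (DST: "`P[ℰ_n(0,n)] ≥ 1 − (1 − P[S_n ⟷ ∂B_n])^{1/8}`").
[cite: DuminilCopinSidoraviciusTassion2016, §2.1 Lemma 4 (proof)] [cite: GrimmettPercolation1999, (11.14) and §1.6 p. 16]
-/

noncomputable section

namespace Summit.CriticalPhenomena.PercolationContinuityZ3.Theorems.Transplant

open MeasureTheory Literature.Probability.Percolation Literature.Probability.LatticeModels SimpleGraph Filter
open scoped Classical Topology

namespace SqShadow

variable {V : Type} {G : SimpleGraph V} (Ψ : SqShadow G)

/-! ## §1 Closed neighbourhoods over squares -/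

/-- **Translation invariance of closed neighbourhoods**: all edges over `sqBall (z + period•t) r` are closed with the probability of all edges over `sqBall z r` being
closed. [folklore] -/
theorem real_edgesClosed_shift [Countable V] (p : unitInterval) (z t : Site 2) (r : ℕ) :
    (bondPercolation G p).real (edgesClosed (Ψ.lift (sqBall (z + (Ψ.period : ℤ) • t) r))) = (bondPercolation G p).real (edgesClosed (Ψ.lift (sqBall z r))) := by
  obtain ⟨γ, hγ⟩ := Ψ.shift t
  set d : Site 2 := (Ψ.period : ℤ) • t with hd
  have hγg : ∀ w, Ψ.sh (γ w) = Equiv.addRight d (Ψ.sh w) := fun w => by rw [Equiv.coe_addRight, hγ]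
  have e1 : Ψ.lift (sqBall (z + d) r) = γ '' Ψ.lift (sqBall z r) := by
    rw [← image_addRight_sqBall d z r, Ψ.image_lift γ (Equiv.addRight d) hγg]
  rw [e1, ← bondPercolation_real_preimage_relabel_iso γ p (edgesClosed (γ '' Ψ.lift (sqBall z r))), preimage_relabel_edgesClosed]

/-- **The uniform closed-neighbourhood constant** `P_p[all edges over sqBall c (2·period) closed]`.
[cite: DuminilCopinSidoraviciusTassion2016, Lemma 4 (proof: "smaller than some constant c < 1 uniformly in n")] -/
def closedConst [Countable V] (p : unitInterval) : ℝ := (bondPercolation G p).real (edgesClosed (Ψ.lift (sqBall Ψ.centre (2 * Ψ.period))))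

/-- The uniform constant is positive for `p < 1`. [folklore] -/
theorem closedConst_pos [Countable V] (p : unitInterval) (hp : (p : ℝ) < 1) : 0 < Ψ.closedConst p :=
  real_edgesClosed_pos G p hp (Ψ.lift_finite (sqBall_finite _ _))

/-- The uniform constant is at most one. [folklore] -/
theorem closedConst_le_one [Countable V] (p : unitInterval) : Ψ.closedConst p ≤ 1 := measureReal_le_one

/-- **Every unit square lies in a translate of `sqBall c (2·period)` by a symmetry translation** (reduce `q − c` modulo `period`). [folklore] -/
theorem exists_sqBall_one_subset (q : Site 2) : ∃ t : Site 2, sqBall q 1 ⊆ sqBall (Ψ.centre + (Ψ.period : ℤ) • t) (2 * Ψ.period) := by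
  set P : ℤ := (Ψ.period : ℤ) with hPdef
  have hP : 0 < P := by rw [hPdef]; exact_mod_cast Ψ.period_pos
  set v : Site 2 := q - Ψ.centre with hv
  refine ⟨![v 0 / P, v 1 / P], fun w hw => ?_⟩
  rw [mem_sqBall_iff_linear] at hw ⊢
  have hr0 : 0 ≤ v 0 % P := Int.emod_nonneg _ hP.ne'
  have hr0' : v 0 % P < P := Int.emod_lt_of_pos _ hP
  have hr1 : 0 ≤ v 1 % P := Int.emod_nonneg _ hP.ne'
  have hr1' : v 1 % P < P := Int.emod_lt_of_pos _ hP
  have hd0 : v 0 % P + P * (v 0 / P) = v 0 := Int.emod_add_mul_ediv _ _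
  have hd1 : v 1 % P + P * (v 1 / P) = v 1 := Int.emod_add_mul_ediv _ _
  have e0 : q 0 = Ψ.centre 0 + v 0 := by simp [hv]
  have e1 : q 1 = Ψ.centre 1 + v 1 := by simp [hv]
  simp only [Pi.add_apply, Pi.smul_apply, smul_eq_mul, Matrix.cons_val_zero, Matrix.cons_val_one]
  rw [e0, e1] at hw
  push_cast
  omega

/-- **Uniform lower bound**: `closedConst ≤ P_p[all edges over sqBall q 1 closed]` for every `q`. [folklore] -/
theorem closedConst_le [Countable V] (p : unitInterval) (q : Site 2) : Ψ.closedConst p ≤ (bondPercolation G p).real (edgesClosed (Ψ.lift (sqBall q 1))) := by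
  obtain ⟨t, ht⟩ := Ψ.exists_sqBall_one_subset q
  unfold closedConst
  rw [← Ψ.real_edgesClosed_shift p Ψ.centre t (2 * Ψ.period)]
  exact measureReal_mono (edgesClosed_anti (Ψ.lift_mono ht))

/-! ## §2 The local bound -/

/-- **An open path from `\\overline{X}` to the column over `q ∉ X` uses an open edge over `sqBall q 1`** (its last edge enters the column from a vertex whose shadow is
within one of `q` in each coordinate). [cite: DuminilCopinSidoraviciusTassion2016, Lemma 4 (proof)] -/
theorem not_mem_edgesClosed_of_conn_point {ω : BondConfig V} (hω : ω ⊆ G.edgeSet) {B X : Set (Site 2)} {q : Site 2} (hq : q ∉ X)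
    (h : ω ∈ Ψ.conn B X {q}) : ω ∉ edgesClosed (Ψ.lift (sqBall q 1)) := by
  obtain ⟨a, ha, b, hb, hab⟩ := h
  rw [mem_lift, Set.mem_singleton_iff] at hb
  have hba : PathIn (openGraph ω) (Ψ.lift B) b a := (mem_openConnIn_iff_pathIn.1 hab).symm
  intro hcl
  rcases hba.exit_or (R := Ψ.lift {q}) (by rw [mem_lift]; exact hb) with h | ⟨x, y, hx, hy, -, hadj, -⟩
  · have haq : a ∈ Ψ.lift {q} := h.right_mem.1
    rw [mem_lift, Set.mem_singleton_iff] at haq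
    rw [mem_lift, haq] at ha
    exact hq ha
  · have hopen : s(x, y) ∈ ω := ((openGraph_adj ω x y).1 hadj).1
    have hlat : G.Adj x y := (SimpleGraph.mem_edgeSet _).1 (hω hopen)
    rw [mem_lift, Set.mem_singleton_iff] at hx
    refine hcl s(x, y) ?_ hopen
    rw [Set.mk_mem_sym2_iff]
    constructor
    · rw [mem_lift, hx]; exact centre_mem_sqBall q 1
    · rw [mem_lift, mem_sqBall, Nat.cast_one, ← hx, abs_sub_comm (Ψ.sh y 0), abs_sub_comm (Ψ.sh y 1)]
      exact ⟨Ψ.abs_sh_sub_sh_le_one hlat 0, Ψ.abs_sh_sub_sh_le_one hlat 1⟩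

/-- **`P[X ⟷^B {q}] ≤ 1 − closedConst`** for `q ∉ X`. [cite: DuminilCopinSidoraviciusTassion2016, Lemma 4 (proof)] -/
theorem real_conn_point_le [Countable V] (p : unitInterval) {B X : Set (Site 2)} {q : Site 2} (hq : q ∉ X) :
    (bondPercolation G p).real (Ψ.conn B X {q}) ≤ 1 - Ψ.closedConst p := by
  set P := bondPercolation G p with hP
  have hle : P.real (Ψ.conn B X {q}) ≤ P.real (edgesClosed (Ψ.lift (sqBall q 1)))ᶜ := by
    refine ENNReal.toReal_mono (measure_ne_top _ _) (measure_mono_ae ?_)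
    filter_upwards [ProbabilityTheory.setBernoulli_ae_subset (u := G.edgeSet) (p := p)] with ω hω hE
    exact Ψ.not_mem_edgesClosed_of_conn_point hω hq hE
  have hcompl : P.real (edgesClosed (Ψ.lift (sqBall q 1)))ᶜ = 1 - P.real (edgesClosed (Ψ.lift (sqBall q 1))) :=
    probReal_compl_eq_one_sub (measurableSet_edgesClosed (Ψ.lift_finite (sqBall_finite q 1)))
  have := Ψ.closedConst_le p q
  linarith

/-- The point side segment: `sqSide z m x x = {z + (m, x)}`. [folklore] -/
theorem sqSide_self (z : Site 2) (m : ℕ) (x : ℤ) : sqSide z m x x = {z + ![(m : ℤ), x]} := by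
  ext w
  simp only [mem_sqSide, Set.mem_singleton_iff]
  constructor
  · rintro ⟨h0, h1, h2⟩
    ext j; fin_cases j
    · simp [h0]
    · simp; omega
  · rintro rfl
    simp only [Pi.add_apply, Matrix.cons_val_zero, Matrix.cons_val_one, true_and]
    omega

/-- **THE LOCAL BOUND `P[E_m(x, x)] ≤ 1 − closedConst`** (`u < m`: the inner square does not reach the side).
[cite: DuminilCopinSidoraviciusTassion2016, Lemma 4 (proof: "P[ℰ_n(0,0)] is smaller than some constant c < 1 uniformly in n")] -/
theorem real_sideEvent_point_le [Countable V] (p : unitInterval) (z : Site 2) {m u : ℕ} (hu : u < m) (x : ℤ) :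
    (bondPercolation G p).real (Ψ.sideEvent z m u x x) ≤ 1 - Ψ.closedConst p := by
  unfold sideEvent
  rw [sqSide_self]
  refine Ψ.real_conn_point_le p ?_
  rw [mem_sqBall_iff_linear]
  simp only [Pi.add_apply, Matrix.cons_val_zero, Matrix.cons_val_one]
  omega

/-! ## §3 `P[E_m(0, m)] → 1` by the square-root trick over the eight half-sides -/

/-- **The full side is likely**: `P[sqBall c v ⟷^{sqBall c m} Σ] ≥ 1 − (1 − P[sqBall c v ⟷^{sqBall c m} sqRing c m])^{1/4}` — the four turned copies of the side
`Σ = sqSide c m (−m) m` cover the boundary and are equiprobable targets (lifted quarter turns). [cite: DuminilCopinSidoraviciusTassion2016, Lemma 4 (proof: "using the symmetries of the box")] -/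
theorem real_sideEvent_full_ge [Countable V] (p : unitInterval) (m v : ℕ) :
    1 - (1 - (bondPercolation G p).real (Ψ.conn (sqBall Ψ.centre m) (sqBall Ψ.centre v) (sqRing Ψ.centre m))) ^ ((4 : ℝ)⁻¹) ≤
      (bondPercolation G p).real (Ψ.sideEvent Ψ.centre m v (-(m : ℤ)) m) := by
  set c := Ψ.centre with hc
  set A : Fin 4 → Set (BondConfig V) := fun j => Ψ.conn (sqBall c m) (sqBall c v) (((sqRotAt c) ^ (j : ℕ)) '' sqSide c m (-(m : ℤ)) m) with hA
  have hcov : Ψ.conn (sqBall c m) (sqBall c v) (sqRing c m) ⊆ ⋃ j, A j :=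
    (Ψ.conn_mono subset_rfl subset_rfl (sqRing_subset_iUnion_side c m)).trans (Ψ.conn_iUnion_right_subset _ _ _)
  have heq : ∀ i j : Fin 4, (bondPercolation G p).real (A i) = (bondPercolation G p).real (A j) := fun i j => by
    simp only [hA, hc, Ψ.real_conn_rotPow]
  have key := sqrt_trick_equiprobable G p A (fun j => isUpperSet_openCrossing _ _ _) (fun j => Ψ.measurableSet_conn (sqBall_finite c m) _ _) hcov heq 0
  simp only [Fintype.card_fin, Nat.cast_ofNat, hA, Fin.val_zero, pow_zero, Equiv.Perm.coe_one, Set.image_id] at key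
  exact key

/-- **`P[E_m(0, m)] → 1`**: if `P[sqBall c v_m ⟷^{sqBall c m} sqRing c m] → 1` then the UPPER HALF-SIDE is reached with probability `→ 1` (`E_m(−m, m) ⊆ E_m(−m, 0) ∪ E_m(0, m)`,
the two halves being exchanged by the lifted flip; altogether exponent `1/8`).
[cite: DuminilCopinSidoraviciusTassion2016, Lemma 4 (proof: "P[ℰ_n(0,n)] ≥ 1 − (1 − P[S_n ⟷ ∂B_n])^{1/8}")] -/
theorem tendsto_real_sideEvent_upper [Countable V] (p : unitInterval) (v : ℕ → ℕ)
    (hD : Tendsto (fun m => (bondPercolation G p).real (Ψ.conn (sqBall Ψ.centre m) (sqBall Ψ.centre (v m)) (sqRing Ψ.centre m))) atTop (𝓝 1)) :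
    Tendsto (fun m => (bondPercolation G p).real (Ψ.sideEvent Ψ.centre m (v m) 0 m)) atTop (𝓝 1) := by
  set c := Ψ.centre with hc
  set P := bondPercolation G p with hP
  -- step 1: the full side
  have h1 : Tendsto (fun m => P.real (Ψ.sideEvent c m (v m) (-(m : ℤ)) m)) atTop (𝓝 1) :=
    tendsto_one_of_sqrt_trick (r := (4 : ℝ)⁻¹) (by norm_num) hD (fun m => measureReal_le_one)
      (Filter.Eventually.of_forall fun m => Ψ.real_sideEvent_full_ge p m (v m))
  -- step 2: the upper half, by the flip
  refine tendsto_one_of_sqrt_trick (r := (2 : ℝ)⁻¹) (by norm_num) h1 (fun m => measureReal_le_one) (Filter.Eventually.of_forall fun m => ?_)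
  have hcov : Ψ.sideEvent c m (v m) (-(m : ℤ)) m ⊆ Ψ.sideEvent c m (v m) 0 m ∪ Ψ.sideEvent c m (v m) (-(m : ℤ)) 0 := by
    intro ω hω
    rcases Ψ.sideEvent_subset_union c m (v m) (-(m : ℤ)) 0 m hω with h | h
    · exact Or.inr h
    · exact Or.inl (Ψ.sideEvent_mono c m (v m) (by norm_num) le_rfl h)
  have hsym : P.real (Ψ.sideEvent c m (v m) (-(m : ℤ)) 0) = P.real (Ψ.sideEvent c m (v m) 0 m) := by
    have := Ψ.real_sideEvent_flip p m (v m) 0 m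
    rw [neg_zero] at this
    exact this
  have := sqrt_trick_two_graph G p (Ψ.isUpperSet_sideEvent c m (v m) 0 m) (Ψ.isUpperSet_sideEvent c m (v m) (-(m : ℤ)) 0)
    (Ψ.measurableSet_sideEvent c m (v m) 0 m) (Ψ.measurableSet_sideEvent c m (v m) (-(m : ℤ)) 0) hcov
  rwa [hsym, max_self] at this

end SqShadow

end Summit.CriticalPhenomena.PercolationContinuityZ3.Theorems.Transplant

end
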